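import Literature.MathematicalPhysics.QuantumFieldTheory.Balaban1983to89.B15Prop1LinearisedAveragingLipschitzNearFlat
import Literature.MathematicalPhysics.QuantumFieldTheory.Balaban1983to89.B15Prop1FlatCoerciveSplit
import Literature.MathematicalPhysics.QuantumFieldTheory.Balaban1983to89.B15AveragingHolomorphicLocalAnalytic
import Literature.MathematicalPhysics.QuantumFieldTheory.Balaban1983to89.B15AveragingHolomorphicTowerRegion
import Literature.MathematicalPhysics.QuantumFieldTheory.Balaban1983to89.B15Prop1LinearisedDatumCoordinates

/-!
# `Balaban1983to89.B15Prop1FlatAverageBoundOfTowerNearFlat` — [Balaban1985Averaging] = «[4]», Sect. D (122)–(126) p. 36, Prop. 4 (134)–(135) pp. 37–39; [Balaban1985BackgroundPropagators]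
# = «[B9]», p. 406 (3.79)–(3.81); [Balaban1985Variational] = «[15]», (44)–(48) p. 285, (82)–(83) p. 290; [Balaban1987RG1] (0.4) p. 253, (0.21) p. 256:
# THE (L) LETTER PER CONSTRAINED BOND, QUALITATIVE CONSTANTS: a field whose `j`-fold average VELOCITY at a tower-guarded, tower-near-flat background `U₀` vanishes at `c` has FLAT
# linearised average `‖(Q_j(1)p̂)(c)‖ ≤ C·δ·‖p̂‖` — `δ` the bondwise flatness of `U₀` ON THE TOWER OF `c` ONLY

Honest framing: statement-level skeleton of published theorems with citation tags; proofs where landed; nothing here is a claim about the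
Yang–Mills mass gap.  Cell `pub-ymgap`, HUMAN RULING D-0062 (Track A), seat `pub-ymgap-dag-n12-c` g25 (lane owner N12 = [B15], strategy s1); count-neutral; N12 NOT discharged;
finite 𝕋⁴ at fixed ε; nothing continuum ∕ OS ∕ mass-gap ∕ Clay.

WHY (lane memo `N12-UNIFORMITY-SPEC.md` §8).  The (β)-split of the (J0′) producer's Lagrangian-positivity row leaves, besides the gauge letter (δ) and dag-n12-w6's multiplier letter (M),
the letter (L) of `B15Prop1FlatCoerciveSplit`: the FLAT linearised averages `(Q_{j_i}(1)p̂)(c_i)` of a real field `p` in the kernel of the linearised constraint AT THE BACKGROUND are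
`O(δ)·‖p‖`.  `B15Prop1LinearisedKernelLevelZero` turns «kernel» into «every average velocity `d∕ds|₀ Ū^{j}(exp(sp)·U₀)(c)` vanishes»; `B15Prop1LinearisedAveragingLipschitzNearFlat` §3 is
the calculus (`DF(V)[Y·V] = 0`, `‖V − 1‖ ≤ r` ⇒ `‖DF(1)Y‖ ≤ C‖V − 1‖‖Y‖` for a `C²` function `F`).  At N12's record `U₀` is (0.4)-guarded and near-flat ONLY ALONG THE CONSTRAINT TOWERS
(LOCATED-E1-HSB; the direct road's (N) clause), so THIS FILE runs the calculus on the lane's tower-local HOLOMORPHIC iterate `F := V ↦ iterMh j V c` ((r1)–(r2) files: tower locality,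
analyticity on the tower polydisc, the guard's openness) through the TOWER SPLICE `Ṽ` (`= ↑U₀` on the tower bonds, `= 1` elsewhere; `‖Ṽ − 1‖ = sup_{tower}‖U₀(b) − 1‖`): print's
«background dependence of the averaging» ([4] (124)–(126), [B9] (3.79)–(3.81)) in qualitative form, with NOTHING asked of `U₀` off the tower.

CONTENTS (theorems only; no `def`, no `instance`, no `sorry`).  §1 `hasDerivAt_coeField_expMul_smul_one` (the flat chart curve `s ↦ ↑(exp(sp)·1)` has velocity `p̂`),
`hasDerivAt_expMulC_line_apply` (the chart curve through a matrix field `W`: velocity `p̂·W`).  §2 ★★★ `exists_norm_dIterL_one_apply_le_of_velocity_zero_towerNearFlat` — per level `j ≤ m + K` and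
coarse bond `c` there are `C ≥ 0`, `r > 0` (depending on `(P, j, c)` ONLY — uniform over backgrounds and base fields): for every `SU(2)` field `U₀` (0.4)-guarded along the tower of `c`, every
`0 ≤ δ ≤ r` with `‖↑U₀(b) − 1‖ ≤ δ` on the level-`0` bonds of the tower region of `c`, and every real field `p` all of whose average velocities at `c` vanish (the kernel reading of
`B15Prop1LinearisedKernelLevelZero` §2), `‖(dIterL j ↑1 p̂)(c)‖ ≤ C·δ·‖p̂‖`.
HONEST SCOPE: calculus + tower bookkeeping over landed lemmas; constants EXISTENTIAL (print's are `O(L²α₀)` with `d`, `L` only — [4] Prop. 3, not claimed); nothing of Bałaban's estimates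
asserted; count-neutral; N12 NOT discharged; the YM mass gap (Clay) is NOT proved by any of this — R4 closes only the conditional finite-𝕋⁴ rung `BalabanLadder.UV`.
-/

noncomputable section

namespace Literature.MathematicalPhysics.QuantumFieldTheory.Balaban1983to89.B15Prop1FlatAverageBoundOfTowerNearFlat

open Set Metric Filter
open scoped Topology
open Literature.Analysis.Calculus.LagrangeHessianRealCoercive (hasDerivAt_comp_realLine)
open Literature.MathematicalPhysics.QuantumFieldTheory.Balaban1983to89.Node00 (SU coeField coeField_apply SmallBelow dIterL dIterL_zero)
open B10Eq42TorusConstraint (bondsIn)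
open B14.Eq22Determines (blockIter)
open B15AveragingHolomorphic (iterMh)
open B15AveragingHolomorphicLocal (iterMh_apply_congr_of_eqOn_bondsIn)
open B15AveragingHolomorphicTowerRegion (preimage_blockIter_saturated self_mem_bondsIn_towerRegion iterMh_coeField_apply_eq_of_guardOn_towerRegion
  differentiableAt_iterMh_apply_of_guardOn_towerRegion)
open B15AveragingHolomorphicLocalAnalytic (analyticAt_iterMh_apply_of_polydiscOn eventually_polydiscOn_one eventually_guardOn)
open B15SU2ChartHolomorphic (genE expMulC expPointC)
open B15Prop1StateChartSU2 (analyticAt_expMulC_right)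
open B15Prop1DatumCoordinates (expMulC_zero_left)
open B15Prop1LinearisedDatumCoordinates (coeField_expMul_smul tendsto_coeField_expMul_smul)
open B15Prop1RightInverseFromLinearisedAveraging (hasDerivAt_coe_avgFamily_expMul_smul)
open B15Prop1FlatCoerciveSplit (smallBelow_one_blockAvg iter_blockAvg_flat_eq_one)
open B15Prop1LinearisedAveragingLipschitzNearFlat (exists_norm_fderiv_one_apply_le_of_kernel)
open B15Prop1AnalyticExtClause (cplxVec)
open B15Prop1ChartCalculusSU2 (E3)
open B15Prop1ChartSU2 (su2Chart)
open B16Sect1Backgrounds (expMul)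
open ExpMeanLog (expMeanLogSU)
open BlockAveraging (blockAvg)
open T4CubeChartGnomonic (SU2)
open T4Continuum B15DeterminingSets GaugeField
open scoped Matrix.Norms.L2Operator

variable {P : Params}

/-! ## §1  The chart curves and their velocities -/

/-- **THE FLAT CHART CURVE HAS VELOCITY `p̂`**: `s ↦ ↑(expMul su2Chart (s•p) 1)` has derivative `p̂ = (Σ_a p_{b,a}E_a)_b` at `0` (NODE 00's velocity theorem at level `0`, where the average is the
field itself and the (0.4) guard is empty). [cite: Balaban1985Variational, (3) p.278, (44) p.285; Balaban1987RG1, (0.21) p.256 (bookkeeping)] -/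
theorem hasDerivAt_coeField_expMul_smul_one (p : VecField P 0 E3) :
    HasDerivAt (fun s : ℝ => coeField (expMul su2Chart (s • p) (1 : GaugeField P 0 SU2)))
      (fun b => ∑ a : Fin 3, ((p b a : ℝ) : ℂ) • genE a) 0 := by
  refine hasDerivAt_pi.2 fun b => ?_
  have h := hasDerivAt_coe_avgFamily_expMul_smul (j := 0) (U₀ := (1 : GaugeField P 0 SU2)) (smallBelow_one_blockAvg (P := P) 0) p b
  have h1 : (((1 : GaugeField P 0 SU2) b : SU2) : Matrix (Fin 2) (Fin 2) ℂ) = 1 := rfl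
  rw [dIterL_zero, ContinuousLinearMap.id_apply, h1, mul_one] at h
  exact h

/-- **THE CHART CURVE THROUGH A MATRIX FIELD `W`**: `s ↦ expMulC ((s:ℂ)•cplxVec p) W` has derivative `p̂·W` at `0` (bondwise `expPointC(s p̂_b)·W_b = ↑(exp(sp)·1)_b·W_b`).
[cite: Balaban1989LargeFieldII, (1.19) p.360; Balaban1985Variational, (44) p.285 (bookkeeping)] -/
theorem hasDerivAt_expMulC_line_apply (p : VecField P 0 E3) (W : PBond P 0 → Matrix (Fin 2) (Fin 2) ℂ) :
    HasDerivAt (fun s : ℝ => expMulC ((0 : VecField P 0 (EuclideanSpace ℂ (Fin 3))) + (s : ℂ) • cplxVec p) W)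
      (fun b => (∑ a : Fin 3, ((p b a : ℝ) : ℂ) • genE a) * W b) 0 := by
  have hflat := hasDerivAt_coeField_expMul_smul_one (P := P) p
  refine hasDerivAt_pi.2 fun b => ?_
  have hb := (hasDerivAt_pi.1 hflat b).mul_const (W b)
  have hfun : (fun s : ℝ => expMulC ((0 : VecField P 0 (EuclideanSpace ℂ (Fin 3))) + (s : ℂ) • cplxVec p) W b) =
      fun s : ℝ => coeField (expMul su2Chart (s • p) (1 : GaugeField P 0 SU2)) b * W b := by
    funext s
    rw [coeField_expMul_smul]
    show expPointC _ * W b = expPointC _ * (((1 : GaugeField P 0 SU2) b : SU2) : Matrix (Fin 2) (Fin 2) ℂ) * W b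
    have h1 : (((1 : GaugeField P 0 SU2) b : SU2) : Matrix (Fin 2) (Fin 2) ℂ) = 1 := rfl
    rw [h1, mul_one]
  rw [hfun]
  exact hb

/-! ## §2  The (L) letter per constrained bond at a tower-guarded, tower-near-flat background -/

/-- ★★★ **THE FLAT AVERAGE OF A VELOCITY-KERNEL FIELD IS `O(δ)` AT A TOWER-NEAR-FLAT BACKGROUND.**  Fix a level `j ≤ m + K` and a coarse bond `c`.  There are `C ≥ 0` and `r > 0`,
depending on `(P, j, c)` only, such that: for every `SU(2)` configuration `U₀` that is (0.4)-guarded along the tower of `c` (the rows the (J0′) producer reads off the class), every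
`0 ≤ δ ≤ r` bounding `‖↑U₀(b) − 1‖` on the level-`0` bonds of the tower region `B^j ⁻¹{c₋, c₊}` of `c` (NOTHING asked off the tower), and every real bond field `p` ALL OF WHOSE average
VELOCITIES at `c` vanish — `d∕ds|₀ ↑Ū^{j}(exp(sp)·U₀)(c) = v ⇒ v = 0`, VERBATIM the conclusion shape of `B15Prop1LinearisedKernelLevelZero.velocity_eq_zero_of_fderiv_sliceDatum_eq_zero_of_guardOn`
(«`p` in the kernel of the linearised constraint») — the FLAT
linearised average obeys `‖(dIterL j ↑1 p̂)(c)‖ ≤ C·δ·‖p̂‖`.  Proof: `F := V ↦ iterMh j V c` is analytic at `1` (tower polydisc at the flat field); the tower splice `Ṽ` of `U₀` is within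
`δ` of `1`; by tower locality and the guard's openness the real average curve through `U₀` is `s ↦ F(expMulC(s p̂)·Ṽ)` near `0`, whose velocity `DF(Ṽ)[p̂·Ṽ]` therefore vanishes;
`B15Prop1LinearisedAveragingLipschitzNearFlat.exists_norm_fderiv_one_apply_le_of_kernel` gives `‖DF(1)[p̂]‖ ≤ C·‖Ṽ − 1‖·‖p̂‖`, and `DF(1)[p̂] = (dIterL j ↑1 p̂)(c)` (both are the
velocity of the flat average curve).
[cite: Balaban1985Averaging, (122)–(126) p.36, Prop. 4 (134)–(135) pp.37–39; Balaban1985BackgroundPropagators, (3.79)–(3.81) p.406; Balaban1985Variational, (44)–(48) p.285, (82)–(83) p.290; Balaban1987RG1, (0.4) p.253, (0.21) p.256] -/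
theorem exists_norm_dIterL_one_apply_le_of_velocity_zero_towerNearFlat (j : ℕ) (hj : j ≤ P.m + P.K) (c : PBond P j) :
    ∃ C r : ℝ, 0 ≤ C ∧ 0 < r ∧ ∀ (U₀ : GaugeField P 0 SU2),
      (∀ j', j' < j → ∀ c' : PBond P (j' + 1), c' ∈ bondsIn (j' + 1) (blockIter j ⁻¹' ({c.src, c.tgt} : Set (Site P j))) →
        BlockAveraging.Small expMeanLogSU (Averaging.iter (fun j => blockAvg (P := P) (j := j) expMeanLogSU) j' U₀) c') →
      ∀ {δ : ℝ}, 0 ≤ δ → δ ≤ r →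
        (∀ b : PBond P 0, b ∈ bondsIn 0 (blockIter j ⁻¹' ({c.src, c.tgt} : Set (Site P j))) → ‖((U₀ b : SU2) : Matrix (Fin 2) (Fin 2) ℂ) - 1‖ ≤ δ) →
        ∀ p : VecField P 0 E3,
          (∀ v : Matrix (Fin 2) (Fin 2) ℂ,
            HasDerivAt (fun s : ℝ => ((avgFamily (fun j => blockAvg (P := P) (j := j) expMeanLogSU) (expMul su2Chart (s • p) U₀) j c : SU2) : Matrix (Fin 2) (Fin 2) ℂ)) v 0 →
              v = 0) →
          ‖dIterL j (coeField (1 : GaugeField P 0 SU2)) (fun b => ∑ a : Fin 3, ((p b a : ℝ) : ℂ) • genE a) c‖ ≤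
            C * δ * ‖(fun b : PBond P 0 => ∑ a : Fin 3, ((p b a : ℝ) : ℂ) • genE a)‖ := by
  classical
  -- the tower region of `c`, saturated below `j`; `c` is one of its level-`j` bonds
  set T : Set (Site P 0) := blockIter j ⁻¹' ({c.src, c.tgt} : Set (Site P j)) with hT
  have hsat := preimage_blockIter_saturated hj ({c.src, c.tgt} : Set (Site P j))
  have hcT : c ∈ bondsIn j T := self_mem_bondsIn_towerRegion hj c
  -- the tower-local holomorphic iterate
  set F : (PBond P 0 → Matrix (Fin 2) (Fin 2) ℂ) → Matrix (Fin 2) (Fin 2) ℂ := fun V => iterMh j V c with hF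
  -- (1) `F` is analytic at the flat field (tower polydisc at `1`, from the flat guard)
  have hg1 : ∀ j', j' < j → ∀ c' : PBond P (j' + 1), c' ∈ bondsIn (j' + 1) T →
      BlockAveraging.Small expMeanLogSU (Averaging.iter (fun j => blockAvg (P := P) (j := j) expMeanLogSU) j' (1 : GaugeField P 0 SU2)) c' := by
    intro j' _ c' _
    rw [iter_blockAvg_flat_eq_one]
    exact T3DescentFibreTower.small_one _ c'
  have hone : coeField (1 : GaugeField P 0 SU2) = (1 : PBond P 0 → Matrix (Fin 2) (Fin 2) ℂ) := by funext b; rfl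
  have hpoly1 := (eventually_polydiscOn_one j hj hsat hg1).self_of_nhds
  rw [hone] at hpoly1
  have hFan : AnalyticAt ℂ F 1 := analyticAt_iterMh_apply_of_polydiscOn j hj hsat hpoly1 c hcT
  have hF2 : ContDiffAt ℂ 2 F 1 := hFan.contDiffAt
  -- (2) the calculus constants
  obtain ⟨C, r, hC, hr, hker⟩ := exists_norm_fderiv_one_apply_le_of_kernel hF2
  refine ⟨C, r, hC, hr, fun U₀ hg δ hδ0 hδr hflatU p hv0 => ?_⟩
  set phat : PBond P 0 → Matrix (Fin 2) (Fin 2) ℂ := fun b => ∑ a : Fin 3, ((p b a : ℝ) : ℂ) • genE a with hphat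
  -- (3) the tower splice of `U₀`
  set Vt : PBond P 0 → Matrix (Fin 2) (Fin 2) ℂ := fun b => if b ∈ bondsIn 0 T then coeField U₀ b else 1 with hVt
  have hVt_on : ∀ b, b ∈ bondsIn 0 T → Vt b = coeField U₀ b := fun b hb => by simp only [hVt, if_pos hb]
  have hVt_norm : ‖Vt - 1‖ ≤ δ := by
    refine (pi_norm_le_iff_of_nonneg hδ0).2 fun b => ?_
    by_cases hb : b ∈ bondsIn 0 T
    · rw [Pi.sub_apply, hVt_on b hb, Pi.one_apply]
      exact hflatU b hb
    · simp only [Pi.sub_apply, hVt, if_neg hb, Pi.one_apply, sub_self, norm_zero]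
      exact hδ0
  -- (4) the real average curve through `U₀` is `s ↦ F(expMulC(s p̂) Ṽ)` near `s = 0`
  have hgs : ∀ᶠ s : ℝ in 𝓝 0, ∀ j', j' < j → ∀ c' : PBond P (j' + 1), c' ∈ bondsIn (j' + 1) T →
      BlockAveraging.Small expMeanLogSU (Averaging.iter (fun j => blockAvg (P := P) (j := j) expMeanLogSU) j' (expMul su2Chart (s • p) U₀)) c' := by
    filter_upwards [(tendsto_coeField_expMul_smul U₀ p).eventually (eventually_guardOn j hj hsat hg)] with s hs
    exact hs (expMul su2Chart (s • p) U₀) rfl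
  have hcurve : (fun s : ℝ => ((avgFamily (fun j => blockAvg (P := P) (j := j) expMeanLogSU) (expMul su2Chart (s • p) U₀) j c : SU2) : Matrix (Fin 2) (Fin 2) ℂ)) =ᶠ[𝓝 0]
      fun s : ℝ => F (expMulC ((0 : VecField P 0 (EuclideanSpace ℂ (Fin 3))) + (s : ℂ) • cplxVec p) Vt) := by
    filter_upwards [hgs] with s hs
    have h1 : iterMh j (coeField (expMul su2Chart (s • p) U₀)) c =
        coeField (Averaging.iter (fun j => blockAvg (P := P) (j := j) expMeanLogSU) j (expMul su2Chart (s • p) U₀)) c :=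
      iterMh_coeField_apply_eq_of_guardOn_towerRegion hj c hs
    have h2 : iterMh j (coeField (expMul su2Chart (s • p) U₀)) c = iterMh j (expMulC ((0 : VecField P 0 (EuclideanSpace ℂ (Fin 3))) + (s : ℂ) • cplxVec p) Vt) c := by
      rw [coeField_expMul_smul]
      refine iterMh_apply_congr_of_eqOn_bondsIn j hj hsat (fun b hb => ?_) c hcT
      show expPointC _ * coeField U₀ b = expPointC _ * Vt b
      rw [hVt_on b hb]
    show _ = iterMh j _ c
    rw [← h2, h1]
    rfl
  -- (5) the model curve's velocity is `DF(Ṽ)[p̂·Ṽ]`, hence zero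
  have hFdiff : DifferentiableAt ℂ F Vt := differentiableAt_iterMh_apply_of_guardOn_towerRegion hj c hg hVt_on
  have hline := hasDerivAt_expMulC_line_apply p Vt
  have hline0 : expMulC ((0 : VecField P 0 (EuclideanSpace ℂ (Fin 3))) + ((0 : ℝ) : ℂ) • cplxVec p) Vt = Vt := by
    rw [Complex.ofReal_zero, zero_smul, add_zero, expMulC_zero_left]
  have hFd' : HasFDerivAt F (fderiv ℂ F Vt) (expMulC ((0 : VecField P 0 (EuclideanSpace ℂ (Fin 3))) + ((0 : ℝ) : ℂ) • cplxVec p) Vt) := by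
    rw [hline0]; exact hFdiff.hasFDerivAt
  have hmodel := (hFd'.restrictScalars ℝ).comp_hasDerivAt (0 : ℝ) hline
  have hreal := hmodel.congr_of_eventuallyEq hcurve
  have hzero : fderiv ℂ F Vt (fun b => phat b * Vt b) = 0 := hv0 _ hreal
  -- (6) the calculus: `‖DF(1)[p̂]‖ ≤ C·‖Ṽ − 1‖·‖p̂‖`
  have hbound := hker Vt phat (hVt_norm.trans hδr) hzero
  -- (7) `DF(1)[p̂]` is the flat velocity `(dIterL j ↑1 p̂)(c)`
  have hg1s : ∀ᶠ s : ℝ in 𝓝 0, ∀ j', j' < j → ∀ c' : PBond P (j' + 1), c' ∈ bondsIn (j' + 1) T →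
      BlockAveraging.Small expMeanLogSU (Averaging.iter (fun j => blockAvg (P := P) (j := j) expMeanLogSU) j' (expMul su2Chart (s • p) (1 : GaugeField P 0 SU2))) c' := by
    filter_upwards [(tendsto_coeField_expMul_smul (1 : GaugeField P 0 SU2) p).eventually (eventually_guardOn j hj hsat hg1)] with s hs
    exact hs (expMul su2Chart (s • p) 1) rfl
  have hcurve1 : (fun s : ℝ => ((avgFamily (fun j => blockAvg (P := P) (j := j) expMeanLogSU) (expMul su2Chart (s • p) (1 : GaugeField P 0 SU2)) j c : SU2) :
      Matrix (Fin 2) (Fin 2) ℂ)) =ᶠ[𝓝 0] fun s : ℝ => F (expMulC ((0 : VecField P 0 (EuclideanSpace ℂ (Fin 3))) + (s : ℂ) • cplxVec p) 1) := by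
    filter_upwards [hg1s] with s hs
    have h1 : iterMh j (coeField (expMul su2Chart (s • p) (1 : GaugeField P 0 SU2))) c =
        coeField (Averaging.iter (fun j => blockAvg (P := P) (j := j) expMeanLogSU) j (expMul su2Chart (s • p) 1)) c :=
      iterMh_coeField_apply_eq_of_guardOn_towerRegion hj c hs
    show _ = iterMh j _ c
    rw [← hone, ← coeField_expMul_smul, h1]
    rfl
  have hline1 := hasDerivAt_expMulC_line_apply p (1 : PBond P 0 → Matrix (Fin 2) (Fin 2) ℂ)
  have hline10 : expMulC ((0 : VecField P 0 (EuclideanSpace ℂ (Fin 3))) + ((0 : ℝ) : ℂ) • cplxVec p) (1 : PBond P 0 → Matrix (Fin 2) (Fin 2) ℂ) = 1 := by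
    rw [Complex.ofReal_zero, zero_smul, add_zero, expMulC_zero_left]
  have hFd1 : HasFDerivAt F (fderiv ℂ F 1) (expMulC ((0 : VecField P 0 (EuclideanSpace ℂ (Fin 3))) + ((0 : ℝ) : ℂ) • cplxVec p) (1 : PBond P 0 → Matrix (Fin 2) (Fin 2) ℂ)) := by
    rw [hline10]; exact hFan.differentiableAt.hasFDerivAt
  have hmodel1 := (hFd1.restrictScalars ℝ).comp_hasDerivAt (0 : ℝ) hline1
  have hphat1 : (fun b => (∑ a : Fin 3, ((p b a : ℝ) : ℂ) • genE a) * (1 : PBond P 0 → Matrix (Fin 2) (Fin 2) ℂ) b) = phat := by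
    funext b; rw [Pi.one_apply, mul_one]
  have hreal1 : HasDerivAt (fun s : ℝ => ((avgFamily (fun j => blockAvg (P := P) (j := j) expMeanLogSU) (expMul su2Chart (s • p) (1 : GaugeField P 0 SU2)) j c : SU2) :
      Matrix (Fin 2) (Fin 2) ℂ)) (fderiv ℂ F 1 phat) 0 := by
    have h := hmodel1.congr_of_eventuallyEq hcurve1
    rw [hphat1] at h
    exact h
  have hnode := hasDerivAt_coe_avgFamily_expMul_smul (U₀ := (1 : GaugeField P 0 SU2)) ((smallBelow_one_blockAvg (P := P) (j + 1)).mono (Nat.le_succ j)) p c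
  have hphat1' : (fun b : PBond P 0 => (∑ a : Fin 3, ((p b a : ℝ) : ℂ) • genE a) * (((1 : GaugeField P 0 SU2) b : SU2) : Matrix (Fin 2) (Fin 2) ℂ)) = phat := by
    funext b
    have h1 : (((1 : GaugeField P 0 SU2) b : SU2) : Matrix (Fin 2) (Fin 2) ℂ) = 1 := rfl
    rw [h1, mul_one]
  rw [hphat1'] at hnode
  have hflatId : fderiv ℂ F 1 phat = dIterL j (coeField (1 : GaugeField P 0 SU2)) phat c := hreal1.unique hnode
  -- (8) assemble
  rw [← hflatId]
  calc ‖fderiv ℂ F 1 phat‖ ≤ C * ‖Vt - 1‖ * ‖phat‖ := hbound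
    _ ≤ C * δ * ‖phat‖ := by
        apply mul_le_mul_of_nonneg_right _ (norm_nonneg _)
        exact mul_le_mul_of_nonneg_left hVt_norm hC

end Literature.MathematicalPhysics.QuantumFieldTheory.Balaban1983to89.B15Prop1FlatAverageBoundOfTowerNearFlat

end
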